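import Mathlib

/-!
# Persistence of a certified zero under a `C¹`-small perturbation

Stub `stub_persistence` of line `Sketch` for the crux `SkeletonEquilibrium`
(route `FilamentSkeletonRss`): if a differentiable `f` is `ε`-close to a model `W`, and `deriv f`
is `ε`-close to `Wd`, on the box `|t| ≤ T`, `f` does not vanish for `|t| ≥ T`, and the model
carries the window certificate (`W a ≤ -m`, `m ≤ W b`, `Wd ≥ s` on `[a, b] ⊆ [-T, T]`,
`|W| ≥ m` on `[-T, T]` off `(a, b)`) with `ε < m`, `ε < s`, then `f` has exactly one zero and
its derivative there is at least `s - ε`.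

Proof: intermediate value theorem on `[a, b]` (existence), strict monotonicity on `[a, b]`
from `deriv f ≥ s - ε > 0` plus `|f| ≥ m - ε > 0` on the box off the window (uniqueness),
and the derivative closeness at the zero (slope).
-/

namespace Summit.NavierStokesRegularity.NavierStokesRegularity.Theorems.SkeletonEquilibrium.Sketch
set_option linter.dupNamespace false

noncomputable section

/-- **Persistence of a certified transversal zero.** If a differentiable `f` is `ε`-close to
`W` and `deriv f` is `ε`-close to `Wd` on `[-T, T]`, `f ≠ 0` for `|t| ≥ T`, and the model
satisfies the window certificate (`W a ≤ -m`, `W b ≥ m`, `Wd ≥ s` on `[a, b] ⊆ [-T, T]`,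
`|W| ≥ m` on `[-T, T] ∖ (a, b)`) with `ε < m` and `ε < s`, then `f` has exactly one zero `ts`,
and `s - ε ≤ deriv f ts`. (IVT on `[a, b]`; strict monotonicity on `[a, b]` from
`deriv f ≥ s - ε > 0`; `|f| ≥ m - ε > 0` on the box off the window.) -/
theorem stub_persistence :
    ∀ (f W Wd : ℝ → ℝ) (a b T m s ε : ℝ), Differentiable ℝ f → -T ≤ a → a < b → b ≤ T →
      0 ≤ ε → ε < m → ε < s →
      W a ≤ -m → m ≤ W b → (∀ t, a ≤ t → t ≤ b → s ≤ Wd t) →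
      (∀ t, -T ≤ t → t ≤ T → (t ≤ a ∨ b ≤ t) → m ≤ |W t|) →
      (∀ t, |t| ≤ T → |f t - W t| ≤ ε ∧ |deriv f t - Wd t| ≤ ε) →
      (∀ t, T ≤ |t| → f t ≠ 0) →
      ∃ ts, f ts = 0 ∧ (∀ t, f t = 0 → t = ts) ∧ s - ε ≤ deriv f ts := by
  intro f W Wd a b T m s ε hf hTa hab hbT _ hεm hεs hWa hWb hWd hWfar hclose hfar
  have hcont : Continuous f := hf.continuous
  -- points of the window lie in the box
  have hbox : ∀ t, a ≤ t → t ≤ b → |t| ≤ T := fun t hat htb =>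
    abs_le.2 ⟨by linarith, by linarith⟩
  -- sign change at the ends of the window
  have hfa : f a < 0 := by
    have h := (abs_le.1 (hclose a (hbox a le_rfl hab.le)).1).2
    linarith
  have hfb : 0 < f b := by
    have h := (abs_le.1 (hclose b (hbox b hab.le le_rfl)).1).1
    linarith
  -- existence of a zero in the window (intermediate value theorem)
  obtain ⟨ts, hts, hfts⟩ : ∃ ts ∈ Set.Icc a b, f ts = 0 :=
    intermediate_value_Icc hab.le hcont.continuousOn ⟨hfa.le, hfb.le⟩
  -- strict monotonicity on the window
  have hmono : StrictMonoOn f (Set.Icc a b) := by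
    refine strictMonoOn_of_deriv_pos (convex_Icc a b) hcont.continuousOn ?_
    intro x hx
    rw [interior_Icc] at hx
    have h := (abs_le.1 (hclose x (hbox x hx.1.le hx.2.le)).2).1
    have hsx := hWd x hx.1.le hx.2.le
    linarith
  refine ⟨ts, hfts, ?_, ?_⟩
  · -- uniqueness
    intro t ht
    have htT : |t| < T := by
      by_contra hcon
      exact hfar t (not_lt.1 hcon) ht
    have htT' : -T < t ∧ t < T := abs_lt.1 htT
    have htab : a < t ∧ t < b := by
      by_contra hcon
      have hor : t ≤ a ∨ b ≤ t := by
        rcases not_and_or.1 hcon with h | h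
        · exact Or.inl (not_lt.1 h)
        · exact Or.inr (not_lt.1 h)
      have hm := hWfar t htT'.1.le htT'.2.le hor
      have hc := (hclose t htT.le).1
      rw [ht, zero_sub, abs_neg] at hc
      linarith
    exact hmono.injOn ⟨htab.1.le, htab.2.le⟩ hts (ht.trans hfts.symm)
  · -- slope at the zero
    have h := (abs_le.1 (hclose ts (hbox ts hts.1 hts.2)).2).1
    have hs := hWd ts hts.1 hts.2
    linarith

end

end Summit.NavierStokesRegularity.NavierStokesRegularity.Theorems.SkeletonEquilibrium.Sketch
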